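import Mathlib
import Summits.CriticalPhenomena.PercolationContinuityZ3.Theorems.PercNearOneGluingAdditiveGluingBhkSets
import Summits.CriticalPhenomena.PercolationContinuityZ3.Theorems.PercNearOneGluingAdditiveGluingKnThm2GoodAux
import Summits.CriticalPhenomena.PercolationContinuityZ3.Theorems.PercNearOneGluingAdditiveGluingKnThm2GoodEvents
import HarnessLib

/-! # Crux `PercNearOneGluing.AdditiveGluing` (stmt-CriticalPhenomena-4576), line
`replica-splice-at-entrance` — stub `stub_oSourceBound` (the o-source two-cluster bound)

Helper file for the crux skeleton of the line `replica-splice-at-entrance` (lead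
prover-line-stmt-CriticalPhenomena-4576-c4-0): proves exactly the registered stub signature
`stub_oSourceBound`; lands with `--supports stmt-CriticalPhenomena-4576`.

## Content

Finite weighted graph on `Fin n` (`μ = prodBernoulli w`, events `{x ↔ y} = openConn x y`), observer `o`,
target `b`, relays `a₁, a₂, a₃`.  With `π_o := C(o) ∩ {a₁, a₂, a₃, b}`,
`q_∅ := {π_o = ∅} = {o ↮ a₁} ∩ {o ↮ a₂} ∩ {o ↮ a₃} ∩ {o ↮ b}`, `q₃ := {π_o = {a₃}}`,
`P₃ := q₃ ∩ {a₁ ↔ b}`, `A := q_∅ ∩ {a₁ ↔ b}`, the stub is `μ(P₃) μ(q_∅) ≤ μ(q₃) μ(A)`.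

Proof (van den Berg–Häggström–Kahn 2006, Thm. 1.4, in the set form `stub_bhkSets.2`): sources
`S = {o}`, `S' = {b, a₁, a₂}`, conditioning event `N = {S ↮ S'} = {o ↮ b} ∩ {o ↮ a₁} ∩ {o ↮ a₂}`,
increasing functions `F = 1{o ↔ a₃ in C}` of `C = C_o` and `G = 1{b ↔ a₁ in C}` of `C = C_{S'}`:
`μ(N) μ(N ∩ {o ↔ a₃} ∩ {b ↔ a₁}) ≤ μ(N ∩ {o ↔ a₃}) μ(N ∩ {b ↔ a₁})`; and the bookkeeping
`N = q_∅ ⊔ q₃`, `N ∩ {o ↔ a₃} = q₃`, `N ∩ {b ↔ a₁} = A ⊔ P₃`, `N ∩ {o ↔ a₃} ∩ {b ↔ a₁} = P₃`, whence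
`(q_∅ + q₃) P₃ ≤ q₃ (A + P₃)`, i.e. `q_∅ P₃ ≤ q₃ A`.
-/

namespace Summit.CriticalPhenomena.PercolationContinuityZ3.Theorems

open MeasureTheory Set
open Literature.Probability.LatticeModels (prodBernoulli)
open Literature.Probability.Percolation (BondConfig openConn openGraph openEdgeCluster
  mem_openEdgeCluster_iff openGraph_mono openEdgeCluster_subset isUpperSet_openConn)

noncomputable section
open Classical

section General

variable {V : Type*}

/-- The indicator of the up-set `{C | x ↔ y in C}` of sets of edges is increasing. [folklore] -/
theorem oSource_monotone_reach (x y : V) :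
    Monotone ({C : Set (Sym2 V) | (openGraph C).Reachable x y}.indicator
      (1 : Set (Sym2 V) → ℝ)) := by
  intro C C' hCC'
  by_cases h : C ∈ {C : Set (Sym2 V) | (openGraph C).Reachable x y}
  · have h' : C' ∈ {C : Set (Sym2 V) | (openGraph C).Reachable x y} :=
      SimpleGraph.Reachable.mono (openGraph_mono hCC') h
    rw [Set.indicator_of_mem h, Set.indicator_of_mem h', Pi.one_apply, Pi.one_apply]
  · rw [Set.indicator_of_notMem h]
    exact Set.indicator_nonneg (fun _ _ => zero_le_one) _

/-- For `x ∈ S`, at `C = C_S(ω) = ⋃_{s ∈ S} C_s(ω)` the indicator of `{C | x ↔ y in C}` is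
`1{x ↔ y}(ω)` (an open path from `x` runs inside `C_x ⊆ C_S ⊆ ω`). [folklore] -/
theorem oSource_reach_apply (S : Finset V) {x : V} (hx : x ∈ S) (y : V) (ω : BondConfig V) :
    {C : Set (Sym2 V) | (openGraph C).Reachable x y}.indicator (1 : Set (Sym2 V) → ℝ)
        (⋃ s' ∈ S, openEdgeCluster ω s') =
      (openConn x y : Set (BondConfig V)).indicator 1 ω := by
  by_cases h : (openGraph ω).Reachable x y
  · have h1 : (⋃ s' ∈ S, openEdgeCluster ω s') ∈
        {C : Set (Sym2 V) | (openGraph C).Reachable x y} :=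
      (knThm2_reachable_biUnion_iff S hx y ω).2 h
    have h2 : ω ∈ (openConn x y : Set (BondConfig V)) := h
    rw [Set.indicator_of_mem h1, Set.indicator_of_mem h2, Pi.one_apply, Pi.one_apply]
  · have h1 : (⋃ s' ∈ S, openEdgeCluster ω s') ∉
        {C : Set (Sym2 V) | (openGraph C).Reachable x y} :=
      fun h' => h ((knThm2_reachable_biUnion_iff S hx y ω).1 h')
    have h2 : ω ∉ (openConn x y : Set (BondConfig V)) := h
    rw [Set.indicator_of_notMem h1, Set.indicator_of_notMem h2]

end General

variable {n : ℕ}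

/-- **BHK 2006 Thm. 1.4 for the clusters of disjoint vertex sets `S, S'`** (second half of the
registered stub `stub_bhkSets`), with `f = 1{S ↔ c}` and `g = 1{b ↔ a}` for a source `b ∈ S'`:
`μ(D) μ(D ∩ {S ↔ c} ∩ {b ↔ a}) ≤ μ(D ∩ {S ↔ c}) μ(D ∩ {b ↔ a})`, `D = {S ↮ S'}`.
[cite: VandenbergHaggstromKahn2005, Thm. 1.4 (p. 7)] -/
theorem oSource_bhkTwo (w : Sym2 (Fin n) → unitInterval) (S S' : Finset (Fin n)) (c a : Fin n)
    {b : Fin n} (hb : b ∈ S') (hSS' : Disjoint S S') :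
    (prodBernoulli w).real
          {ω : BondConfig (Fin n) | ∀ s ∈ S, ∀ x ∈ S', ¬ (openGraph ω).Reachable s x} *
        (prodBernoulli w).real
          ({ω : BondConfig (Fin n) | ∀ s ∈ S, ∀ x ∈ S', ¬ (openGraph ω).Reachable s x} ∩
            ((⋃ s ∈ S, openConn s c) ∩ openConn b a)) ≤
      (prodBernoulli w).real
          ({ω : BondConfig (Fin n) | ∀ s ∈ S, ∀ x ∈ S', ¬ (openGraph ω).Reachable s x} ∩
            ⋃ s ∈ S, openConn s c) *
        (prodBernoulli w).real
          ({ω : BondConfig (Fin n) | ∀ s ∈ S, ∀ x ∈ S', ¬ (openGraph ω).Reachable s x} ∩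
            openConn b a) := by
  have key := stub_bhkSets.2 n w S S'
    ({C : Set (Sym2 (Fin n)) | ∃ s ∈ S, (openGraph C).Reachable s c}.indicator 1)
    ({C : Set (Sym2 (Fin n)) | (openGraph C).Reachable b a}.indicator 1)
    (knThm2_monotone_anyReach S c) (oSource_monotone_reach b a) hSS'
  simp only [knThm2_anyReach_apply, oSource_reach_apply S' hb] at key
  have h := knThm2_setIntegral_indicator w
    {ω : BondConfig (Fin n) | ∀ s ∈ S, ∀ x ∈ S', ¬ (openGraph ω).Reachable s x}
    (⋃ s ∈ S, openConn s c) (openConn b a)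
  have h' := knThm2_setIntegral_indicator w
    {ω : BondConfig (Fin n) | ∀ s ∈ S, ∀ x ∈ S', ¬ (openGraph ω).Reachable s x}
    (openConn b a) (openConn b a)
  rw [h.1, h'.1, h.2] at key
  exact key

/-- The conditioning event `{S ↮ S'}` for `S = {o}`, `S' = {b, a₁, a₂}` is
`{o ↮ b} ∩ {o ↮ a₁} ∩ {o ↮ a₂}`. [folklore] -/
theorem oSource_sep (o b a₁ a₂ : Fin n) :
    {ω : BondConfig (Fin n) | ∀ s ∈ ({o} : Finset (Fin n)), ∀ x ∈ ({b, a₁, a₂} : Finset (Fin n)),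
        ¬ (openGraph ω).Reachable s x} =
      (openConn o b)ᶜ ∩ (openConn o a₁)ᶜ ∩ (openConn o a₂)ᶜ := by
  ext ω
  simp only [Finset.mem_insert, Finset.mem_singleton, forall_eq_or_imp, forall_eq,
    Set.mem_setOf_eq, Set.mem_inter_iff, Set.mem_compl_iff, and_assoc]
  exact Iff.rfl

/-- **Registered stub `stub_oSourceBound`** (the o-source two-cluster bound):
`μ(P₃) μ(q_∅) ≤ μ(q₃) μ(q_∅ ∩ {a₁ ↔ b})` with `q_∅ = {o ↮ a₁, a₂, a₃, b}`,
`q₃ = {o ↔ a₃} ∩ {o ↮ a₁, a₂, b}`, `P₃ = q₃ ∩ {a₁ ↔ b}`.  Proof: `oSource_bhkTwo` (vdBHK 2006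
Thm. 1.4 via `stub_bhkSets.2`) with `S = {o}`, `S' = {b, a₁, a₂}`, `N = {o ↮ b, a₁, a₂}`,
`F = 1{o ↔ a₃}`, `G = 1{b ↔ a₁}`, and the bookkeeping `N = q_∅ ⊔ q₃`, `N ∩ {o ↔ a₃} = q₃`,
`N ∩ {b ↔ a₁} = (q_∅ ∩ {a₁ ↔ b}) ⊔ P₃`, `N ∩ {o ↔ a₃} ∩ {b ↔ a₁} = P₃`.
[cite: VandenbergHaggstromKahn2005, Thm. 1.4 (p. 7)] -/
theorem stub_oSourceBound :
    ∀ (n : ℕ) (w : Sym2 (Fin n) → unitInterval) (o b a₁ a₂ a₃ : Fin n), o ≠ b → o ≠ a₁ → o ≠ a₂ →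
      (prodBernoulli w).real (openConn o a₃ ∩ (openConn o a₁)ᶜ ∩ (openConn o a₂)ᶜ ∩ (openConn o b)ᶜ ∩ openConn a₁ b) *
          (prodBernoulli w).real ((openConn o a₁)ᶜ ∩ (openConn o a₂)ᶜ ∩ (openConn o a₃)ᶜ ∩ (openConn o b)ᶜ) ≤
        (prodBernoulli w).real (openConn o a₃ ∩ (openConn o a₁)ᶜ ∩ (openConn o a₂)ᶜ ∩ (openConn o b)ᶜ) *
          (prodBernoulli w).real ((openConn o a₁)ᶜ ∩ (openConn o a₂)ᶜ ∩ (openConn o a₃)ᶜ ∩ (openConn o b)ᶜ ∩ openConn a₁ b) := by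
  intro n w o b a₁ a₂ a₃ hob ho1 ho2
  have hSS' : Disjoint ({o} : Finset (Fin n)) {b, a₁, a₂} := by simp [hob, ho1, ho2]
  have hb : b ∈ ({b, a₁, a₂} : Finset (Fin n)) := by simp
  have key := oSource_bhkTwo w {o} {b, a₁, a₂} a₃ a₁ hb hSS'
  rw [oSource_sep, Finset.set_biUnion_singleton, knThm2_openConn_comm b a₁] at key
  -- names for the events
  set N : Set (BondConfig (Fin n)) := (openConn o b)ᶜ ∩ (openConn o a₁)ᶜ ∩ (openConn o a₂)ᶜ
    with hN
  set Q0 : Set (BondConfig (Fin n)) :=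
    (openConn o a₁)ᶜ ∩ (openConn o a₂)ᶜ ∩ (openConn o a₃)ᶜ ∩ (openConn o b)ᶜ with hQ0
  set Q3 : Set (BondConfig (Fin n)) :=
    openConn o a₃ ∩ (openConn o a₁)ᶜ ∩ (openConn o a₂)ᶜ ∩ (openConn o b)ᶜ with hQ3
  -- the bookkeeping
  have e1 : N = Q0 ∪ Q3 := by
    ext ω
    simp only [hN, hQ0, hQ3, Set.mem_inter_iff, Set.mem_compl_iff, Set.mem_union]
    tauto
  have d1 : Disjoint Q0 Q3 := by
    refine Set.disjoint_left.2 fun ω h0 h3 => ?_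
    simp only [hQ0, hQ3, Set.mem_inter_iff, Set.mem_compl_iff] at h0 h3
    exact h0.1.2 h3.1.1.1
  have e2 : N ∩ openConn o a₃ = Q3 := by
    ext ω
    simp only [hN, hQ3, Set.mem_inter_iff, Set.mem_compl_iff]
    tauto
  have e3 : N ∩ openConn a₁ b = Q0 ∩ openConn a₁ b ∪ Q3 ∩ openConn a₁ b := by
    ext ω
    simp only [hN, hQ0, hQ3, Set.mem_inter_iff, Set.mem_compl_iff, Set.mem_union]
    tauto
  have d3 : Disjoint (Q0 ∩ openConn a₁ b) (Q3 ∩ openConn a₁ b) :=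
    Set.disjoint_left.2 fun ω h0 h3 => Set.disjoint_left.1 d1 h0.1 h3.1
  have e4 : N ∩ (openConn o a₃ ∩ openConn a₁ b) = Q3 ∩ openConn a₁ b := by
    ext ω
    simp only [hN, hQ3, Set.mem_inter_iff, Set.mem_compl_iff]
    tauto
  rw [e1, measureReal_union d1 MeasurableSet.of_discrete, ← e1, e2, e3,
    measureReal_union d3 MeasurableSet.of_discrete, e4] at key
  have hP : 0 ≤ (prodBernoulli w).real (Q3 ∩ openConn a₁ b) := measureReal_nonneg
  linarith [key, hP]

end

end Summit.CriticalPhenomena.PercolationContinuityZ3.Theorems
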